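import Summits.BirchSwinnertonDyer.BirchSwinnertonDyer.Theorems.ByReductionTypeAtTwoOrdKatoHalfAtTwoIsoStepFourOfInl
import HarnessLib

/-!
# Route ByReductionTypeAtTwo, crux `OrdKatoHalfAtTwoIso` (stmt-BirchSwinnertonDyer-19573), line `steinberg-fibre-at-two`
# (skeleton v11), stub `stub_coreA_posDisc : CoreTheoremAPosDiscTwo` (the core Theorem A at `2` on `0 < Δ`): STEP 4 WITH THE
# ARCHIMEDEAN VANISHING REQUIRED OF THE PAIRED CLASS ONLY (`hxinf`), not of the whole local `H¹` (`hinf`) — plan item (P1)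
# of the lead's `STUB-BRIEF-stub_coreA_posDisc.md`

Seat `cruxlead-stmt-BirchSwinnertonDyer-19573-g5` (LEAD PROVER, MODE LINE; HOME `run/shared/lean/pub/bsd-2adic/`; `--supports`
stmt-BirchSwinnertonDyer-19573 as helper). THEOREMS ONLY. HONEST FRAMING (cell bsd-2adic): BSD is not proved by any of this;
the crux is not proved; the stub `CoreTheoremAPosDiscTwo` (p684479) is NOT proved here — this file removes the ONLY use of the
sign `Δ_W < 0` from the interface of Step 4, nothing more.

WHY. In the line's Ω2 = (H-K) (`…KolyvaginRankOneTwo.lean`, p668150) the sign `Δ < 0` is used at exactly one call,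
`StepFour.convCoeff_eq_zero_of_qTermIdentity_modPTwist_two … hΔ` (`…StepFourOfInl.lean`, p662576), to discharge
`hinf : H¹(ℚ_w, 𝒯_J(E)) = 0` at every infinite place `w` (H14, true iff complex conjugation is a transposition on `E[2]`
iff `Δ < 0`). But the Poitou–Tate bookkeeping consumes `hinf` ONLY through
`StepFour.localTerm_eq_zero_of_localization_left_eq_zero inv ρ (Sum.inl w) (hinf w x) y` — i.e. only the localisation at
`w` of THE LEFT (Kolyvagin-side) class that is actually paired, and of its shifts `T^k x`. At `0 < Δ` the local group
`H¹(ℚ_w, 𝒯_J(E)) = 𝒯_J(E)` is NOT zero, while the real component of the Kolyvagin class of a prime `q ≡ 1 (mod 4)` is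
expected to vanish ((c − 1)·D ≡ (m/2)·N (mod 2) on `Gal(ℚ(μ_q)/ℚ)`, `m = q − 1`; brief (P2)). So this file re-threads
§§1–3 of `…StepFourOfInl.lean` with

* `hxinf : ∀ w, loc_{Sum.inl w} x = 0` (generic lemmas, the one class `x`), resp.
* `hxinf : ∀ w k, loc_{Sum.inl w} (T^[k] x) = 0` (the stub-hypothesis shapes, where Step 4 is applied to every shift of the
  Kolyvagin class),

in place of `hinf`, proofs otherwise VERBATIM (each a few lines over the tree's Step-4 lemmas), and records (§4) that the
old `hinf`/`Δ < 0` forms are instances (`…_of_inl'`, `…_modPTwist_two'`). The `p = 2` curve form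
`convCoeff_eq_zero_of_qTermIdentity_modPTwist_two_of_xinf` is the drop-in replacement for the `hΔ` call of p668150 in the
`0 < Δ` assembly (brief (P4)).

References: B. Mazur, K. Rubin, Mem. AMS 799 (2004) Prop. 1.3.2, §4.4 [MazurRubin2004]; J. S. Milne, *Arithmetic Duality
Theorems* (2006) I Thm. 4.10 (b), Rem. 3.7 [MilneADT2006]; J.-P. Serre, *Galois Cohomology* (1997) I §2.4
[SerreGaloisCohomology1997]; tree `…StepFourOfInl.lean` (p662576), `…X9StepFourReciprocity{,Sets,Seams,Twist}.lean`,
`…X9StepFourFinal.lean`; HOME MU-TRANSFER-PROOF §5 STEP 4.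
-/

set_option autoImplicit false
-- the summit and its single problem are both named `BirchSwinnertonDyer` (registry layout D-0017)
set_option linter.dupNamespace false

noncomputable section

open scoped ContRepresentation
open Function NumberField IsDedekindDomain Field Finset
open scoped NumberField
open Literature.NumberTheory.GaloisRepresentations
open Literature.NumberTheory.GaloisRepresentations.DiscreteGaloisModule (mu MuCarrier pairing TateDual
  tateDual pairingDualIntertwining)
open Literature.NumberTheory.GaloisCohomology
open Literature.NumberTheory.EllipticCurves
open Summit.BirchSwinnertonDyer.Rank1Residual.GaloisImage
open _root_.TopRep _root_.ContRepresentation _root_.ContinuousCohomology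

universe u

namespace Summit.BirchSwinnertonDyer.BirchSwinnertonDyer.Rank1Residual.StepFour

variable {K : Type u} [Field K] [NumberField K]

/-! ### §1 Generic: `hxinf` on the one paired class instead of `hinf` on all classes -/

/-- **STEP 4 (reciprocity) with the archimedean vanishing required of the LEFT class only.** `inv` a family of local
invariant maps with the Poitou–Tate vanishing, `M` finite discrete killed by `n`, `S` a set of finite places, `q` a
finite place; if the localisation of `x` at every infinite place vanishes (`hxinf`), `loc_v x`, `loc_v y` are unramified
at every finite `v ∉ S`, `v ≠ q` where inertia fixes `M` and `M^D`, and the local terms vanish on `S`, then the local term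
at `q` vanishes. Verbatim `localTerm_inr_eq_zero_of_unramified_outside_set_of_inl` (p662576) with `hinf w x ↦ hxinf w`.
[cite: MilneADT2006, Ch. I, Thm. 4.10(b)] -/
theorem localTerm_inr_eq_zero_of_unramified_outside_set_of_xinf
    {M : Type u} [AddCommGroup M] [TopologicalSpace M] [DiscreteTopology M] [Finite M] {n : ℕ}
    [NeZero n] {inv : LocalInvariants K n} (hPT : inv.SumLocalTermEqZero) (ρ : DiscreteGaloisModule K M)
    (hM : ∀ m : M, n • m = 0)
    (S : Set (HeightOneSpectrum (𝓞 K))) (q : HeightOneSpectrum (𝓞 K))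
    (x : galoisCohomology ρ 1) (y : galoisCohomology (ρ.tateDual n) 1)
    (hxinf : ∀ w : InfinitePlace K, galoisCohomology.localization ρ (Sum.inl w) 1 x = 0)
    (hI : ∀ v ∉ S, v ≠ q → ∀ t ∈ absInertia (v.adicCompletion K), ∀ m : M,
      GaloisRep.toLocal v ρ t m = m)
    (hID : ∀ v ∉ S, v ≠ q → ∀ t ∈ absInertia (v.adicCompletion K),
      ∀ f : DiscreteGaloisModule.TateDual K M n, GaloisRep.toLocal v (ρ.tateDual n) t f = f)
    (hx : ∀ v ∉ S, v ≠ q → galoisCohomology.localization ρ (Sum.inr v) 1 x ∈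
      DiscreteGaloisModule.unramifiedSubgroup (GaloisRep.toLocal v ρ) 1)
    (hy : ∀ v ∉ S, v ≠ q → galoisCohomology.localization (ρ.tateDual n) (Sum.inr v) 1 y ∈
      DiscreteGaloisModule.unramifiedSubgroup (GaloisRep.toLocal v (ρ.tateDual n)) 1)
    (hS : ∀ v ∈ S, inv.localTerm ρ (Sum.inr v) x y = 0) :
    inv.localTerm ρ (Sum.inr q) x y = 0 := by
  classical
  refine hPT.localTerm_eq_zero ρ hM x y (Sum.inr q) fun v hv => ?_
  rcases v with w | v
  · exact localTerm_eq_zero_of_localization_left_eq_zero inv ρ (Sum.inl w) (hxinf w) y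
  · by_cases hvS : v ∈ S
    · exact hS v hvS
    · have hvq : v ≠ q := fun h => hv (by rw [h])
      exact localTerm_inr_eq_zero_of_mem_unramifiedSubgroup inv ρ v (hI v hvS hvq)
        (hID v hvS hvq) (hx v hvS hvq) (hy v hvS hvq)

section Generic

variable {M : Type u} [AddCommGroup M] [TopologicalSpace M] [DiscreteTopology M] [Finite M] {n : ℕ}
variable {M₂ : Type u} [AddCommGroup M₂] [TopologicalSpace M₂] [DiscreteTopology M₂]
variable {ρ₁ : DiscreteGaloisModule K M} {ρ₂ : DiscreteGaloisModule K M₂}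
variable {B : M →+ M₂ →+ MuCarrier K n}
variable (hB : ∀ (σ : absoluteGaloisGroup K) (x : M) (y : M₂), B (ρ₁ σ x) (ρ₂ σ y) = mu K n σ (B x y))
include hB

/-- **STEP 4 for an equivariant pairing `B : M₁ × M₂ → μₙ`, `S` a set, archimedean vanishing of the LEFT class only**
(local-term form, `S` discharged by `loc_v y = 0`). Verbatim `localTerm_pairingDual_eq_zero_of_unramified_outside_set_of_inl`
with `hinf ↦ hxinf`. [cite: MilneADT2006, Ch. I, Thm. 4.10(b)] -/
theorem localTerm_pairingDual_eq_zero_of_unramified_outside_set_of_xinf [NeZero n]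
    {inv : LocalInvariants K n} (hPT : inv.SumLocalTermEqZero) (hM : ∀ m : M, n • m = 0)
    (S : Set (HeightOneSpectrum (𝓞 K))) (q : HeightOneSpectrum (𝓞 K))
    (x : galoisCohomology ρ₁ 1) (y : galoisCohomology ρ₂ 1)
    (hxinf : ∀ w : InfinitePlace K, galoisCohomology.localization ρ₁ (Sum.inl w) 1 x = 0)
    (hI : ∀ v ∉ S, v ≠ q → ∀ t ∈ absInertia (v.adicCompletion K), ∀ m : M,
      GaloisRep.toLocal v ρ₁ t m = m)
    (hID : ∀ v ∉ S, v ≠ q → ∀ t ∈ absInertia (v.adicCompletion K), ∀ f : TateDual K M n,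
      GaloisRep.toLocal v (ρ₁.tateDual n) t f = f)
    (hx : ∀ v ∉ S, v ≠ q → galoisCohomology.localization ρ₁ (Sum.inr v) 1 x ∈
      DiscreteGaloisModule.unramifiedSubgroup (GaloisRep.toLocal v ρ₁) 1)
    (hy : ∀ v ∉ S, v ≠ q → galoisCohomology.localization ρ₂ (Sum.inr v) 1 y ∈
      DiscreteGaloisModule.unramifiedSubgroup (GaloisRep.toLocal v ρ₂) 1)
    (hS : ∀ v ∈ S, galoisCohomology.localization ρ₂ (Sum.inr v) 1 y = 0) :
    inv.localTerm ρ₁ (Sum.inr q) x (galoisCohomology.map (pairingDualIntertwining hB) 1 y) = 0 := by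
  refine localTerm_inr_eq_zero_of_unramified_outside_set_of_xinf hPT ρ₁ hM S q x _ hxinf hI hID hx
    (fun v hvS hvq => localization_map_mem_unramifiedSubgroup _ v (hy v hvS hvq)) fun v hvS => ?_
  refine localTerm_eq_zero_of_localization_right_eq_zero inv ρ₁ (Sum.inr v) x ?_
  rw [localization_map_eq, hS v hvS]
  exact map_zero _

end Generic

/-! ### §2 The Iwasawa twists: `hxinf` on the Kolyvagin class and its shifts instead of `hinf` -/

section Twist

variable {p : ℕ} [Fact p.Prime] (κ : ZpExtension K p)
variable {M M' : Type u} [AddCommGroup M] [TopologicalSpace M] [DiscreteTopology M] [Finite M]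
  [AddCommGroup M'] [TopologicalSpace M'] [DiscreteTopology M']
variable (ρ : DiscreteGaloisModule K M) (ρ' : DiscreteGaloisModule K M')
  (hM : ∀ x : M, p • x = 0) (hM' : ∀ x : M', p • x = 0) (J : ℕ)
variable {e : M →+ M' →+ MuCarrier K p}
  (he : ∀ (g : absoluteGaloisGroup K) (m : M) (m' : M'), e (ρ g m) (ρ' g m') = mu K p g (e m m'))
include he

/-- **STEP 4 on the Iwasawa twists, `S` a set, archimedean vanishing of the LEFT class only.** Verbatim
`localTerm_twistDualMap_eq_zero_of_unramified_outside_set_of_inl` with `hinf ↦ hxinf`. [cite: MilneADT2006, Ch. I, Thm. 4.10(b)] -/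
theorem localTerm_twistDualMap_eq_zero_of_unramified_outside_set_of_xinf
    {inv : LocalInvariants K p} (hPT : inv.SumLocalTermEqZero)
    (S : Set (HeightOneSpectrum (𝓞 K))) (q : HeightOneSpectrum (𝓞 K))
    (hSp : ∀ v ∉ S, v ≠ q → ((p : ℕ) : 𝓞 K) ∉ v.asIdeal)
    (hur : ∀ v ∉ S, v ≠ q → GaloisRep.IsUnramifiedAt v ρ)
    (x : galoisCohomology (κ.twistModP ρ hM J) 1)
    (hxinf : ∀ w : InfinitePlace K, galoisCohomology.localization (κ.twistModP ρ hM J) (Sum.inl w) 1 x = 0)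
    (y : galoisCohomology (κ.invTwist.twistModP ρ' hM' J) 1)
    (hx : ∀ v ∉ S, v ≠ q → galoisCohomology.localization (κ.twistModP ρ hM J) (Sum.inr v) 1 x ∈
      DiscreteGaloisModule.unramifiedSubgroup (GaloisRep.toLocal v (κ.twistModP ρ hM J)) 1)
    (hy : ∀ v ∉ S, v ≠ q →
      galoisCohomology.localization (κ.invTwist.twistModP ρ' hM' J) (Sum.inr v) 1 y ∈
        DiscreteGaloisModule.unramifiedSubgroup (GaloisRep.toLocal v (κ.invTwist.twistModP ρ' hM' J)) 1)
    (hS : ∀ v ∈ S, galoisCohomology.localization (κ.invTwist.twistModP ρ' hM' J) (Sum.inr v) 1 y = 0) :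
    inv.localTerm (κ.twistModP ρ hM J) (Sum.inr q) x
      (galoisCohomology.map (κ.twistDualMap ρ ρ' p hM hM' J he) 1 y) = 0 := by
  haveI : NeZero p := ⟨(Fact.out : p.Prime).ne_zero⟩
  exact localTerm_pairingDual_eq_zero_of_unramified_outside_set_of_xinf
    (κ.gorensteinPairing_twistModP_smul ρ ρ' (mu K p) hM hM' J he)
    hPT (nsmul_twist_eq_zero hM J) S q x y hxinf
    (fun v hvS hvq _ ht z =>
      toLocal_twistModP_apply_of_mem_absInertia κ ρ hM J v (hur v hvS hvq) (hSp v hvS hvq) ht z)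
    (fun v hvS hvq _ ht f =>
      toLocal_tateDual_twistModP_apply_of_mem_absInertia κ ρ hM J v (hur v hvS hvq) (hSp v hvS hvq) ht f)
    hx hy hS

/-- **STEP 4 on the twists in the stub's hypothesis shape, archimedean vanishing of the Kolyvagin class AND ITS SHIFTS**
(`hxinf : ∀ w k, loc_w (T^[k] x) = 0`; Step 4 is applied to every `T^k x`). Verbatim
`localTerm_iterate_shiftH1_eq_zero_of_stub_hypotheses_of_inl` with `hinf ↦ hxinf`. [cite: MilneADT2006, Ch. I, Thm. 4.10(b)] -/
theorem localTerm_iterate_shiftH1_eq_zero_of_stub_hypotheses_of_xinf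
    {inv : LocalInvariants K p} (hPT : inv.SumLocalTermEqZero)
    (S : Set (HeightOneSpectrum (𝓞 K))) (q : HeightOneSpectrum (𝓞 K)) (hq : q ∉ S)
    (hSp : ∀ v ∉ S, ((p : ℕ) : 𝓞 K) ∉ v.asIdeal)
    (hur : ∀ v ∉ S, GaloisRep.IsUnramifiedAt v ρ)
    (x : galoisCohomology (κ.twistModP ρ hM J) 1)
    (hxinf : ∀ (w : InfinitePlace K) (k : ℕ),
      galoisCohomology.localization (κ.twistModP ρ hM J) (Sum.inl w) 1 ((κ.shiftH1 ρ hM J)^[k] x) = 0)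
    (hx : ∀ v ∉ S, v ≠ q → galoisCohomology.localization (κ.twistModP ρ hM J) (Sum.inr v) 1 x ∈
      DiscreteGaloisModule.unramifiedSubgroup (GaloisRep.toLocal v (κ.twistModP ρ hM J)) 1)
    (Ψ : galoisCohomology (κ.invTwist.twistModP ρ' hM' J) 1)
    (hΨ : ∀ v ∉ S, galoisCohomology.localization (κ.invTwist.twistModP ρ' hM' J) (Sum.inr v) 1 Ψ ∈
      DiscreteGaloisModule.unramifiedSubgroup (GaloisRep.toLocal v (κ.invTwist.twistModP ρ' hM' J)) 1)
    (ε : ℕ)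
    (hΨS : ∀ v ∈ S, galoisCohomology.localization (κ.invTwist.twistModP ρ' hM' J) (Sum.inr v) 1
      ((κ.invTwist.shiftH1 ρ' hM' J)^[ε] Ψ) = 0)
    (k : ℕ) :
    inv.localTerm (κ.twistModP ρ hM J) (Sum.inr q) ((κ.shiftH1 ρ hM J)^[k] x)
      (galoisCohomology.map (κ.twistDualMap ρ ρ' p hM hM' J he) 1
        ((κ.invTwist.shiftH1 ρ' hM' J)^[ε] Ψ)) = 0 := by
  have _ := hq
  exact localTerm_twistDualMap_eq_zero_of_unramified_outside_set_of_xinf κ ρ ρ' hM hM' J he hPT S q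
    (fun v hvS _ => hSp v hvS) (fun v hvS _ => hur v hvS) _ (fun w => hxinf w k) _
    (fun v hvS hvq => iterate_shiftH1_localization_mem_unramifiedSubgroup κ ρ hM J v (hx v hvS hvq) k)
    (fun v hvS _ => iterate_shiftH1_localization_mem_unramifiedSubgroup κ.invTwist ρ' hM' J v (hΨ v hvS) ε)
    hΨS

variable [LocallyCompactSpace (absoluteGaloisGroup K)]

/-- **STEP 4 in the stub's hypothesis shape, read on local classes at `q`, archimedean vanishing of the Kolyvagin class and
its shifts**: `inv_q(T_q^k (loc_q x) ∪ loc_q (T^ε Ψ)) = 0` for every `k`. Verbatim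
`inv_cupProduct_restrict_iterate_localShift_eq_zero_of_stub_hypotheses_of_inl` with `hinf ↦ hxinf`.
[cite: MilneADT2006, Ch. I, Thm. 4.10(b)] -/
theorem inv_cupProduct_restrict_iterate_localShift_eq_zero_of_stub_hypotheses_of_xinf
    {inv : LocalInvariants K p} (hPT : inv.SumLocalTermEqZero)
    (S : Set (HeightOneSpectrum (𝓞 K))) (q : HeightOneSpectrum (𝓞 K)) (hq : q ∉ S)
    [LocallyCompactSpace (absoluteGaloisGroup (Place.Completion (Sum.inr q : Place K)))]
    (hSp : ∀ v ∉ S, ((p : ℕ) : 𝓞 K) ∉ v.asIdeal)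
    (hur : ∀ v ∉ S, GaloisRep.IsUnramifiedAt v ρ)
    (x : galoisCohomology (κ.twistModP ρ hM J) 1)
    (hxinf : ∀ (w : InfinitePlace K) (k : ℕ),
      galoisCohomology.localization (κ.twistModP ρ hM J) (Sum.inl w) 1 ((κ.shiftH1 ρ hM J)^[k] x) = 0)
    (hx : ∀ v ∉ S, v ≠ q → galoisCohomology.localization (κ.twistModP ρ hM J) (Sum.inr v) 1 x ∈
      DiscreteGaloisModule.unramifiedSubgroup (GaloisRep.toLocal v (κ.twistModP ρ hM J)) 1)
    (Ψ : galoisCohomology (κ.invTwist.twistModP ρ' hM' J) 1)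
    (hΨ : ∀ v ∉ S, galoisCohomology.localization (κ.invTwist.twistModP ρ' hM' J) (Sum.inr v) 1 Ψ ∈
      DiscreteGaloisModule.unramifiedSubgroup (GaloisRep.toLocal v (κ.invTwist.twistModP ρ' hM' J)) 1)
    (ε : ℕ)
    (hΨS : ∀ v ∈ S, galoisCohomology.localization (κ.invTwist.twistModP ρ' hM' J) (Sum.inr v) 1
      ((κ.invTwist.shiftH1 ρ' hM' J)^[ε] Ψ) = 0)
    (k : ℕ) :
    inv (Sum.inr q)
      (((κ.twistContPairing ρ ρ' (mu K p) hM hM' J he).restrict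
          (absGaloisRestrict K (Place.Completion (Sum.inr q : Place K)))).cupProduct
        ((galoisCohomology.map ((κ.twistModPShift ρ hM J).restrictField (q.adicCompletion K)) 1)^[k]
          (galoisCohomology.localization (κ.twistModP ρ hM J) (Sum.inr q) 1 x))
        (galoisCohomology.localization (κ.invTwist.twistModP ρ' hM' J) (Sum.inr q) 1
          ((κ.invTwist.shiftH1 ρ' hM' J)^[ε] Ψ))) = 0 := by
  rw [← localization_iterate_shiftH1, ← localization_cupProduct_twistContPairing]
  have h := localTerm_iterate_shiftH1_eq_zero_of_stub_hypotheses_of_xinf κ ρ ρ' hM hM' J he hPT S q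
    hq hSp hur x hxinf hx Ψ hΨ ε hΨS k
  rw [show κ.twistDualMap ρ ρ' p hM hM' J he = pairingDualIntertwining
      (κ.gorensteinPairing_twistModP_smul ρ ρ' (mu K p) hM hM' J he) from rfl,
    DiscreteGaloisModule.localTerm_pairingDual] at h
  exact h

/-- **The G3/G4 meeting point (generic twists), archimedean vanishing of the Kolyvagin class and its shifts: STEP 4 + the
`q`-term identity ⟹ `C_i(c(res τ_q), Ψc(res Fr_q)) = 0` for every `i + ε < J`.** Verbatim
`convCoeff_eq_zero_of_qTermIdentity_of_inl` with `hinf ↦ hxinf` (now stated for the cocycle `c` that is paired).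
[cite: MazurRubin2004, Prop. 1.3.2 and §4.4] [cite: MilneADT2006, Ch. I, Thm. 4.10(b)] -/
theorem convCoeff_eq_zero_of_qTermIdentity_of_xinf
    {inv : LocalInvariants K p}
    (hPT : inv.SumLocalTermEqZero) (S : Set (HeightOneSpectrum (𝓞 K))) (q : HeightOneSpectrum (𝓞 K))
    (hq : q ∉ S) [LocallyCompactSpace (absoluteGaloisGroup (Place.Completion (Sum.inr q : Place K)))]
    (hSp : ∀ v ∉ S, ((p : ℕ) : 𝓞 K) ∉ v.asIdeal) (hur : ∀ v ∉ S, GaloisRep.IsUnramifiedAt v ρ)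
    (c : contOneCocycles (κ.twistModP ρ hM J).toTopRep)
    (hxinf : ∀ (w : InfinitePlace K) (k : ℕ),
      galoisCohomology.localization (κ.twistModP ρ hM J) (Sum.inl w) 1
        ((κ.shiftH1 ρ hM J)^[k] (oneCocycleClass (κ.twistModP ρ hM J).toTopRep c)) = 0)
    (hx : ∀ v ∉ S, v ≠ q → galoisCohomology.localization (κ.twistModP ρ hM J) (Sum.inr v) 1
        (oneCocycleClass (κ.twistModP ρ hM J).toTopRep c) ∈
      DiscreteGaloisModule.unramifiedSubgroup (GaloisRep.toLocal v (κ.twistModP ρ hM J)) 1)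
    (Ψc : contOneCocycles (κ.invTwist.twistModP ρ' hM' J).toTopRep)
    (hΨ : ∀ v ∉ S, galoisCohomology.localization (κ.invTwist.twistModP ρ' hM' J) (Sum.inr v) 1
        (oneCocycleClass (κ.invTwist.twistModP ρ' hM' J).toTopRep Ψc) ∈
      DiscreteGaloisModule.unramifiedSubgroup (GaloisRep.toLocal v (κ.invTwist.twistModP ρ' hM' J)) 1)
    (ε : ℕ)
    (hΨS : ∀ v ∈ S, galoisCohomology.localization (κ.invTwist.twistModP ρ' hM' J) (Sum.inr v) 1
      ((κ.invTwist.shiftH1 ρ' hM' J)^[ε] (oneCocycleClass (κ.invTwist.twistModP ρ' hM' J).toTopRep Ψc)) = 0)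
    (τq Frq : absoluteGaloisGroup (q.adicCompletion K))
    {R : Type*} [CommRing R] (ι : ZMod p →+ R) (ι' : MuCarrier K p →+ R) (hι' : Function.Injective ι')
    (u : ℕ → R) (hu : IsUnit (u 0))
    (hQ : ∀ k < J, ι (inv (Sum.inr q)
        (((κ.twistContPairing ρ ρ' (mu K p) hM hM' J he).restrict
            (absGaloisRestrict K (Place.Completion (Sum.inr q : Place K)))).cupProduct
          ((galoisCohomology.map ((κ.twistModPShift ρ hM J).restrictField (q.adicCompletion K)) 1)^[J - 1 - k]
            (galoisCohomology.localization (κ.twistModP ρ hM J) (Sum.inr q) 1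
              (oneCocycleClass (κ.twistModP ρ hM J).toTopRep c)))
          (galoisCohomology.localization (κ.invTwist.twistModP ρ' hM' J) (Sum.inr q) 1
            ((κ.invTwist.shiftH1 ρ' hM' J)^[ε]
              (oneCocycleClass (κ.invTwist.twistModP ρ' hM' J).toTopRep Ψc))))) =
      ∑ j ∈ range (k + 1), u j * ι' (convCoeff e J (k - j)
        (c.1 (absGaloisRestrict K (q.adicCompletion K) τq))
        ((shiftEnd M' J ^ ε) (Ψc.1 (absGaloisRestrict K (q.adicCompletion K) Frq))))) :
    ∀ i, i + ε < J → convCoeff e J i (c.1 (absGaloisRestrict K (q.adicCompletion K) τq))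
      (Ψc.1 (absGaloisRestrict K (q.adicCompletion K) Frq)) = 0 := by
  refine convCoeff_eq_zero_of_family_eq_zero e ι' hι' hu ε _ _ fun k hk => ?_
  rw [← hQ k hk, inv_cupProduct_restrict_iterate_localShift_eq_zero_of_stub_hypotheses_of_xinf κ ρ ρ' hM hM'
    J he hPT S q hq hSp hur _ hxinf hx _ hΨ ε hΨS (J - 1 - k), map_zero]

end Twist

/-! ### §3 The `p = 2` instance on the objects of the Ω road (`ℚ`, `W.modPTwist 2 κ J`, a Weil pairing `eW`), ANY sign of
`Δ`: the archimedean vanishing of the Kolyvagin cocycle and its shifts is the hypothesis `hxinf` -/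

section CurveTwo

variable (W : WeierstrassCurve ℚ) (κ : ZpExtension ℚ 2)
variable (eW : WeierstrassCurve.geomTorsion W ((2 : ℕ) : ℤ) → WeierstrassCurve.geomTorsion W ((2 : ℕ) : ℤ) →
    AlgebraicClosure ℚ)
  (hμ : ∀ S T, eW S T ^ 2 = 1) (hadd₁ : ∀ S₁ S₂ T, eW (S₁ + S₂) T = eW S₁ T * eW S₂ T)
  (hadd₂ : ∀ S T₁ T₂, eW S (T₁ + T₂) = eW S T₁ * eW S T₂)
  (hgal : ∀ (σ : absoluteGaloisGroup ℚ) (S T : WeierstrassCurve.geomTorsion W ((2 : ℕ) : ℤ)),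
    σ • eW S T = eW (σ • S) (σ • T))

/-- **The G3/G4 meeting point of the Ω road on its own objects at `p = 2`, FOR EITHER SIGN OF `Δ(E)`**: as
`convCoeff_eq_zero_of_qTermIdentity_modPTwist_two` (p662576) with `hΔ : W.Δ < 0` REPLACED by
`hxinf : ∀ w k, loc_w (T^[k] [c]) = 0` — the real components of the Kolyvagin cocycle `c` and of its shifts vanish (at
`0 < Δ`: Kolyvagin primes `q ≡ 1 (mod 4)`, brief (P2); at `Δ < 0`: automatic, §4). Conclusion:
`convCoeff (weilPairingHom …) J i (c(res τ_q)) (Ψc(res Fr_q)) = 0` for all `i + ε < J`.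
[cite: MazurRubin2004, Prop. 1.3.2 and §4.4] [cite: MilneADT2006, Ch. I, Thm. 4.10(b)] -/
theorem convCoeff_eq_zero_of_qTermIdentity_modPTwist_two_of_xinf [W.IsElliptic]
    [Finite (WeierstrassCurve.geomTorsion W ((2 : ℕ) : ℤ))] [LocallyCompactSpace (absoluteGaloisGroup ℚ)]
    {inv : LocalInvariants ℚ 2} (hPT : inv.SumLocalTermEqZero) (J : ℕ)
    (S : Set (HeightOneSpectrum (𝓞 ℚ))) (q : HeightOneSpectrum (𝓞 ℚ)) (hq : q ∉ S)
    [LocallyCompactSpace (absoluteGaloisGroup (Place.Completion (Sum.inr q : Place ℚ)))]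
    (hSp : ∀ v ∉ S, ((2 : ℕ) : 𝓞 ℚ) ∉ v.asIdeal)
    (hur : ∀ v ∉ S, GaloisRep.IsUnramifiedAt v (W.torsionGaloisModule ((2 : ℕ) : ℤ)))
    (c : contOneCocycles (W.modPTwist 2 κ J).toTopRep)
    (hxinf : ∀ (w : InfinitePlace ℚ) (k : ℕ),
      galoisCohomology.localization (W.modPTwist 2 κ J) (Sum.inl w) 1
        ((κ.shiftH1 (W.torsionGaloisModule ((2 : ℕ) : ℤ))
          (fun P : WeierstrassCurve.geomTorsion W ((2 : ℕ) : ℤ) => AddSubgroup.torsionBy.nsmul P) J)^[k]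
          (oneCocycleClass (W.modPTwist 2 κ J).toTopRep c)) = 0)
    (hx : ∀ v ∉ S, v ≠ q → galoisCohomology.localization (W.modPTwist 2 κ J) (Sum.inr v) 1
        (oneCocycleClass (W.modPTwist 2 κ J).toTopRep c) ∈
      DiscreteGaloisModule.unramifiedSubgroup (GaloisRep.toLocal v (W.modPTwist 2 κ J)) 1)
    (Ψc : contOneCocycles (W.modPTwist 2 κ.invTwist J).toTopRep)
    (hΨ : ∀ v : HeightOneSpectrum (𝓞 ℚ), v ∉ S →
      galoisCohomology.localization (W.modPTwist 2 κ.invTwist J) (Sum.inr v) 1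
          (oneCocycleClass (W.modPTwist 2 κ.invTwist J).toTopRep Ψc) ∈
        DiscreteGaloisModule.unramifiedSubgroup (GaloisRep.toLocal v (W.modPTwist 2 κ.invTwist J)) 1)
    (ε : ℕ)
    (hΨS : ∀ v : HeightOneSpectrum (𝓞 ℚ), v ∈ S →
      galoisCohomology.localization (W.modPTwist 2 κ.invTwist J) (Sum.inr v) 1
        ((κ.invTwist.shiftH1 (W.torsionGaloisModule ((2 : ℕ) : ℤ))
          (fun P : WeierstrassCurve.geomTorsion W ((2 : ℕ) : ℤ) => AddSubgroup.torsionBy.nsmul P) J)^[ε]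
          (oneCocycleClass (W.modPTwist 2 κ.invTwist J).toTopRep Ψc)) = 0)
    (τq Frq : absoluteGaloisGroup (q.adicCompletion ℚ))
    {R : Type*} [CommRing R] (ι : ZMod 2 →+ R) (ι' : MuCarrier ℚ 2 →+ R) (hι' : Function.Injective ι')
    (u : ℕ → R) (hu : IsUnit (u 0))
    (hQ : ∀ k < J, ι (inv (Sum.inr q)
        (((κ.twistContPairing (W.torsionGaloisModule ((2 : ℕ) : ℤ)) (W.torsionGaloisModule ((2 : ℕ) : ℤ))
              (mu ℚ 2) (fun P => AddSubgroup.torsionBy.nsmul P) (fun P => AddSubgroup.torsionBy.nsmul P) J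
              (weilPairingHom_torsionGaloisModule_smul W 2 eW hμ hadd₁ hadd₂ hgal)).restrict
            (absGaloisRestrict ℚ (Place.Completion (Sum.inr q : Place ℚ)))).cupProduct
          ((galoisCohomology.map ((κ.twistModPShift (W.torsionGaloisModule ((2 : ℕ) : ℤ))
              (fun P => AddSubgroup.torsionBy.nsmul P) J).restrictField (q.adicCompletion ℚ)) 1)^[J - 1 - k]
            (galoisCohomology.localization (W.modPTwist 2 κ J) (Sum.inr q) 1
              (oneCocycleClass (W.modPTwist 2 κ J).toTopRep c)))
          (galoisCohomology.localization (W.modPTwist 2 κ.invTwist J) (Sum.inr q) 1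
            ((κ.invTwist.shiftH1 (W.torsionGaloisModule ((2 : ℕ) : ℤ))
              (fun P : WeierstrassCurve.geomTorsion W ((2 : ℕ) : ℤ) => AddSubgroup.torsionBy.nsmul P) J)^[ε]
              (oneCocycleClass (W.modPTwist 2 κ.invTwist J).toTopRep Ψc))))) =
      ∑ j ∈ range (k + 1), u j * ι' (convCoeff (weilPairingHom W 2 eW hμ hadd₁ hadd₂) J (k - j)
        (c.1 (absGaloisRestrict ℚ (q.adicCompletion ℚ) τq))
        ((shiftEnd (WeierstrassCurve.geomTorsion W ((2 : ℕ) : ℤ)) J ^ ε)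
          (Ψc.1 (absGaloisRestrict ℚ (q.adicCompletion ℚ) Frq))))) :
    ∀ i, i + ε < J → convCoeff (weilPairingHom W 2 eW hμ hadd₁ hadd₂) J i
      (c.1 (absGaloisRestrict ℚ (q.adicCompletion ℚ) τq)) (Ψc.1 (absGaloisRestrict ℚ (q.adicCompletion ℚ) Frq)) =
      0 := by
  unfold WeierstrassCurve.modPTwist at c hx Ψc hΨ hΨS hQ hxinf ⊢
  exact convCoeff_eq_zero_of_qTermIdentity_of_xinf κ (W.torsionGaloisModule ((2 : ℕ) : ℤ))
    (W.torsionGaloisModule ((2 : ℕ) : ℤ)) (fun P => AddSubgroup.torsionBy.nsmul P)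
    (fun P => AddSubgroup.torsionBy.nsmul P) J
    (weilPairingHom_torsionGaloisModule_smul W 2 eW hμ hadd₁ hadd₂ hgal) hPT S q hq hSp hur c hxinf hx Ψc hΨ ε
    hΨS τq Frq ι ι' hι' u hu hQ

/-! ### §4 Conservativity: at `Δ < 0` the hypothesis `hxinf` holds for every class (H14), so p662576's form is an instance -/

/-- At `Δ(E) < 0`, `hxinf` holds for EVERY class and every shift (H14: the whole local `H¹` at a real place vanishes).
[cite: SerreGaloisCohomology1997, I §2.4 (the case G = Gal(ℂ/ℝ))] -/
theorem hxinf_of_Δ_neg [W.IsElliptic] (hΔ : W.Δ < 0) (J : ℕ)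
    (x : galoisCohomology (W.modPTwist 2 κ J) 1) (w : InfinitePlace ℚ) (k : ℕ) :
    galoisCohomology.localization (W.modPTwist 2 κ J) (Sum.inl w) 1
      ((κ.shiftH1 (W.torsionGaloisModule ((2 : ℕ) : ℤ))
        (fun P : WeierstrassCurve.geomTorsion W ((2 : ℕ) : ℤ) => AddSubgroup.torsionBy.nsmul P) J)^[k] x) = 0 :=
  localization_inl_modPTwist_two_eq_zero_of_Δ_neg W κ hΔ J w _

end CurveTwo

end Summit.BirchSwinnertonDyer.BirchSwinnertonDyer.Rank1Residual.StepFour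

end
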